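import Literature.MathematicalPhysics.QuantumFieldTheory.BalabanImbrieJaffe1984to88.BIJ88SlotConnectedGraph310KPLoc
import Literature.MathematicalPhysics.QuantumFieldTheory.BalabanImbrieJaffe1984to88.BIJ88W6PrimeVsuppBound

/-!
# `BalabanImbrieJaffe1984to88.BIJ88W6PrimeVsuppLoc` — T. Bałaban, J. Imbrie, A. Jaffe, *Effective action and cluster properties of the abelian Higgs
model*, Commun. Math. Phys. **114** (1988) 257–315 [BalabanImbrieJaffe1988], Sect. 5.14 p. 310 [PDF 54], display 4 and the sentence following it
(*"ℛ_k(Λ₁₂^{(k)}) = Σ_{X⊂Λ₁₂^{(k)}} W₆^{(k)′}(X). Here W₆^{(k)′}(X) is obtained by summing only over {X_γ}, (Y₁, …, Y_B) which fill X … The result is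
|W₆^{(k)′}(X)| ≤ (e^β(L^kε/ε₀)^{1/4−α})^{n̄+1+β′|X|}"*): **THE PRINTED `W₆′` CHAIN OF GEN 13 (`BIJ88W6PrimeVsupp` §§3–4, `BIJ88W6PrimeVsuppBound` §§2–3)
RE-DERIVED FROM THE LEAF (5.14.4) IN THE LOCATED READING** (p. 309: *"Here H_β ⊂ H specifies which (d/dt)_{γ_j} have supports intersecting X_β"*) —
located twins, VERBATIM conclusions, of `integrand_eq_cornerSum`, `DIn_eq_iteratedDeriv_log_ztIn`, `intervalIntegrable_weight_DIn`, `W6v_eq_cornerSum`,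
**`display4`**, `remR_sum_Tsum_eq_sum_W6v`, `abs_integrand_le`, `abs_W6v_le`, `abs_W6v_le_rpow`, **`ineqW6'_W6v`** (r16's typed leaf `IneqW6'` for the
printed `W6v`).

statement-level skeleton of published theorems with citation tags; proofs where landed; nothing here is a claim about the Yang–Mills mass gap

WHY (GAPS G-C2-p36-07; siblings `BIJ88Ineq5144Located`, `BIJ88SlotConnectedGraph310KPLoc`): the landed originals take the leaf for the located data of
the (sub-)regions in the UNLOCATED instantiation `Ineq5144 (cubeSys I) (Finset L) (actIn … X t γ) card (H X″ ↦ |X″ ∖ (cubeIn X ∘ γ) H|) θ β′`, which is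
unsatisfiable for `θ < 1` (`BIJ88Ineq5144Located.not_ineq5144_unlocated`; for sub-region data every cube off the sub-region refutes it): vacuous as
stated.  Here every `h5144` is the leaf BY NAME on the LOCATED activity `locAct (cubeIn cube X ∘ γ) (actIn … X t γ)` (`ineq5144_locAct_iff` = the
support-conditioned (5.14.4) of the print); the proofs are the landed ones with the leaf lemmas replaced by their located twins
(`TsumFill_vsupp_eq_cornerSum_of_ineq5144_loc`, `abs_TsumFill_vsupp_le_of_ineq5144_loc`, `sum_Tsum_univ_eq_iteratedDeriv_log_zG_of_ineq5144_loc`).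
Each twin implies its landed original (`ineq5144_locAct_of_unlocated`).  PDF held: `paper:balaban1988-cmp114-bij-abelian-higgs-effective-action`
(journal page = PDF page + 256); p. 310 = PDF 54 read this session.
HONEST SCOPE: as gen 13 — (5.14.4) NOT proved (typed leaf, located reading); `W₆″`/`𝒫^L` are r16's p. 311 lineage; slip G-C2-p36-06; gen 5's
regime.  0 `sorry`, 0 definitions, 0 `Prop` facts (D-0026); imports `BIJ88SlotConnectedGraph310KPLoc` (p36 g14), `BIJ88W6PrimeVsuppBound` (p36 g13).
NOT summit progress; NOT continuum; NOT Clay.  Cell `lit-balaban` Phase 2, seat p36 gen 14 (rows C2.Claim@310 / C2.Eq5.14.5 member cells, owner r16).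
-/

noncomputable section

open Finset MeasureTheory ProbabilityTheory Filter
open scoped Topology
open Literature.MathematicalPhysics.QuantumFieldTheory.BalabanImbrieJaffe1984to88
open BIJ88DirichletForms305 (interpForm)
open BIJ88PolymerRep5134 (g1 corner)
open BIJ88PolymerRep5134Gauss (ext prec expect zG)
open BIJ88Expansion5143 (g3 prime)
open BIJ88Expansion5143Gauss (fD)
open BIJ88Expansion5143Ordered (polysOf cvsupp locv wv cubesOf cubesOf_vsupp wv_vsupp)
open BIJ88Expansion5143Obs (mem_polysOf)
open BIJ88ConnectedGraphResummation (Tsum)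
open BIJ88ConnectedGraphFilling (TsumFill TordFill cornerSum_congr cornerSum_finset_sum)
open BIJ88ConnectedGraphFillingVsupp (Tsum_vsupp_eq_zero_of_not_mem TsumFill_vsupp_eq_zero_of_not_mem)
open BIJ88Clusters5134 (cornerSum sum_powerset_cornerSum)
open BIJ88SlotMoments308 (zt zt_eq slotFactor)
open BIJ88SlotMomentsGauss308 (uD continuous_ext measurable_ext)
open BIJ88EffectiveActionGauss308 (remR_congr_Ioc)
open BIJ88EffectiveActionL1Remainder308 (integrableOn_remainderDensity_of_L1)
open BIJ88GaussShellModulus309 (continuous_and_zero_of_mod)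
open BIJ88Eq5145CornerModulus (slotFields_L1_mod_regionLaw)
open BIJ88Ineq5113Covering (cubeSys cubeSys_card)
open BIJ88Sect2Statements (pLog)
open BIJ88Sect5Statements (CutoffProfile cutoff)
open BIJ88Sect5StatementsPart2 (Ineq5144 IneqW6')
open BIJ88Sect5StatementsPart4 (remR)
open BIJ88W6PrimeBound (mul_pow_mul_rpow_le_one)
open BIJ88Eq5145CornerModel
open BIJ88Eq5145CornerUrsell (cubeIn cubeIn_mem interpForm_abutting ztIn_eq_zG_located)
open BIJ88W6PrimeVsupp (actIn TIn DIn W6v W6v_def sum_filter_supp_Tsum_eq_DIn ztIn_pos_of_Ioc remR_finset_sum)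
open BIJ88W6PrimeVsuppBound (W6v_eq_zero_of_not_subset card_filter_supp_le abs_remR_le_of_bound)
open BIJ88Ineq5144Located (locAct TsumFill_vsupp_eq_cornerSum_of_ineq5144_loc abs_TsumFill_vsupp_le_of_ineq5144_loc)
open BIJ88SlotConnectedGraph310KPLoc (sum_Tsum_univ_eq_iteratedDeriv_log_zG_of_ineq5144_loc)

namespace Literature.MathematicalPhysics.QuantumFieldTheory.BalabanImbrieJaffe1984to88.BIJ88W6PrimeVsuppLoc

variable {α I : Type} [Fintype α] [DecidableEq α] [Fintype I] [DecidableEq I]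
  (blk : α → I) (Δ : Matrix α α ℝ) (ℱ : α → ℝ)
variable (adj : I → I → Prop) [DecidableRel adj]
variable (χ : CutoffProfile) {ι υ : Type*} [DecidableEq ι] [DecidableEq υ]
variable {p ek : ℝ} {B : Finset ι} {Φ : ι → (α → ℝ) → ℝ} {c : ι → ℝ} {Ys : Finset υ} {V : υ → (α → ℝ) → ℝ}
variable {cube : ↥B ⊕ ↥Ys → I} (Λ : Finset I)

/-! ## §1 `W₆′` as the Möbius inverse of the sub-region remainders and display 4, from the located leaf (gen 13 `BIJ88W6PrimeVsupp` §§3–4) -/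
/-- **THE INTEGRAND OF `W₆′(X)` IS THE CORNER SUM OF THE SUB-REGION INTEGRANDS, MODULO (5.14.4)**: for `X ⊆ W₀`, `t` with the leaf (5.14.4) for the
data of `W₀`, `Σ_{γ : supp ⊆ X} T^{fill X}_{γ,t}(L) = Σ_{X' ⊆ X} (−1)^{|X∖X'|} D_{X'}(t)` — the `X`-piece is the corner sum of the sub-region truncated
functions (`BIJ88ConnectedGraphFillingVsupp.TsumFill_vsupp_eq_cornerSum_of_ineq5144_loc`), corner sums commute with the assignment sum, an assignment
not supported in `X'` contributes nothing to the `X'`-gas, and the assignments supported in `X'` are those of `X'` with its own data (§1).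
[cite: BalabanImbrieJaffe1988, p.310 display 4 and the sentence following it; (5.14.4) p.309] -/
theorem integrand_eq_cornerSum_loc {nbr : I → Finset I} {D : ℕ} {θ β' : ℝ} (hR : ∀ x y, adj x y → adj y x) (hD : ∀ x, (nbr x).card ≤ D)
    (hnbr : ∀ x y, adj x y → y ∈ nbr x) (hθ0 : 0 < θ) (hθ1 : θ ≤ 1) (hβ : 0 ≤ β') (hsmall : 16 * ((D : ℝ) + 1) ^ 2 * (θ ^ (β' / 2) * Real.exp 2) ≤ 1)
    {X W₀ : Finset I} (hXW : X ⊆ W₀) (L : Type) [Fintype L] [DecidableEq L] [Nonempty L] {t : ℝ}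
    (h5144 : ∀ γ : L → ↥(slotB B Ys cube W₀) ⊕ ↥(slotY B Ys cube W₀), Ineq5144 (cubeSys I) (Finset L)
      (locAct (cubeIn cube W₀ ∘ γ) (actIn blk Δ ℱ adj χ p ek B Φ c Ys V cube Λ W₀ t γ)) Finset.card (fun H (X'' : Finset I) => (X'' \ H.image (cubeIn cube W₀ ∘ γ)).card) θ β') :
    ∑ γ ∈ univ.filter (fun γ : L → ↥(slotB B Ys cube W₀) ⊕ ↥(slotY B Ys cube W₀) => ∀ l, cubeIn cube W₀ (γ l) ∈ X),
        TsumFill ((polysOf W₀).image (cvsupp adj W₀)) (locv (cubeIn cube W₀ ∘ γ)) (wv (actIn blk Δ ℱ adj χ p ek B Φ c Ys V cube Λ W₀ t γ))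
          cubesOf X univ =
      cornerSum (fun X' => DIn blk Δ ℱ adj χ p ek B Φ c Ys V cube Λ X' L t) X := by
  calc ∑ γ ∈ univ.filter (fun γ : L → ↥(slotB B Ys cube W₀) ⊕ ↥(slotY B Ys cube W₀) => ∀ l, cubeIn cube W₀ (γ l) ∈ X),
        TsumFill ((polysOf W₀).image (cvsupp adj W₀)) (locv (cubeIn cube W₀ ∘ γ)) (wv (actIn blk Δ ℱ adj χ p ek B Φ c Ys V cube Λ W₀ t γ))
          cubesOf X univ
      = ∑ γ ∈ univ.filter (fun γ : L → ↥(slotB B Ys cube W₀) ⊕ ↥(slotY B Ys cube W₀) => ∀ l, cubeIn cube W₀ (γ l) ∈ X),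
          cornerSum (fun X' => Tsum ((polysOf X').image (cvsupp adj X')) (locv (cubeIn cube W₀ ∘ γ))
            (wv (actIn blk Δ ℱ adj χ p ek B Φ c Ys V cube Λ W₀ t γ)) univ) X :=
        sum_congr rfl fun γ _ => TsumFill_vsupp_eq_cornerSum_of_ineq5144_loc hR hD hnbr hθ0 hθ1 hβ hsmall (h5144 γ) hXW univ_nonempty
    _ = cornerSum (fun X' => ∑ γ ∈ univ.filter (fun γ : L → ↥(slotB B Ys cube W₀) ⊕ ↥(slotY B Ys cube W₀) => ∀ l, cubeIn cube W₀ (γ l) ∈ X),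
          Tsum ((polysOf X').image (cvsupp adj X')) (locv (cubeIn cube W₀ ∘ γ)) (wv (actIn blk Δ ℱ adj χ p ek B Φ c Ys V cube Λ W₀ t γ)) univ) X :=
        (cornerSum_finset_sum _ _ X).symm
    _ = cornerSum (fun X' => DIn blk Δ ℱ adj χ p ek B Φ c Ys V cube Λ X' L t) X := cornerSum_congr fun X' hX' => by
        rw [← sum_filter_supp_Tsum_eq_DIn blk Δ ℱ adj χ Λ (hX'.trans hXW) t]
        refine (sum_subset (fun γ hγ => ?_) fun γ _ hγ => ?_).symm
        · simp only [mem_filter, mem_univ, true_and] at hγ ⊢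
          exact fun l => hX' (hγ l)
        · simp only [mem_filter, mem_univ, true_and, not_forall] at hγ
          obtain ⟨l, hl⟩ := hγ
          exact Tsum_vsupp_eq_zero_of_not_mem ⟨l, mem_univ _, hl⟩

/-- **`D_X(t) = (d/dt)^{|L|} log z_t(X)(Λ)` ON THE BRANCH `t ∈ (0,1]`, MODULO (5.14.4)** ((5.14.2) + displays 1–3 for the located data of the
region `X`: p36 g11's `BIJ88SlotConnectedGraph310KP.sum_Tsum_univ_eq_iteratedDeriv_log_zG_of_ineq5144_loc` for the form `Δ_{1_Λ}` and p25's located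
slots, `z(X)(Λ) = z_t` by p25's `ztIn_eq_zG_located`; a region without slots has `D_X = 0 = (log 1)^{(n)}`).  `χ ≥ 0`, `p ≥ 0`, `Δ ≻ 0`
coupling abutting cubes only, continuous cube-local slot fields vanishing at `0`, `c_b ≥ c₀ > 0`, measurable bounded cube-local terms,
`0 < e_k < e^{−1}`. [cite: BalabanImbrieJaffe1988, (5.14.2) p.308; p.310 displays 1–3; (5.14.4) p.309] -/
theorem DIn_eq_iteratedDeriv_log_ztIn_loc {nbr : I → Finset I} {D : ℕ} {θ β' : ℝ} (hR : ∀ x y, adj x y → adj y x)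
    (hD : ∀ x, (nbr x).card ≤ D) (hnbr : ∀ x y, adj x y → y ∈ nbr x) (hθ0 : 0 < θ) (hθ1 : θ ≤ 1) (hβ : 0 ≤ β')
    (hsmall : 16 * ((D : ℝ) + 1) ^ 2 * (θ ^ (β' / 2) * Real.exp 2) ≤ 1) (hχ : ∀ x, 0 ≤ χ.χ₁ x) (hp : 0 ≤ p)
    (hΔadj : ∀ x y, blk x ≠ blk y → ¬ adj (blk x) (blk y) → Δ x y = 0) (hΔ : Δ.PosDef)
    (hΦloc : ∀ b : B, ∀ φ ψ : α → ℝ, (∀ x, blk x = cube (Sum.inl b) → φ x = ψ x) → Φ b φ = Φ b ψ)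
    (hVloc : ∀ Y : Ys, ∀ φ ψ : α → ℝ, (∀ x, blk x = cube (Sum.inr Y) → φ x = ψ x) → V Y φ = V Y ψ)
    (hΦc : ∀ b ∈ B, Continuous (Φ b)) (hΦ0 : ∀ b ∈ B, Φ b 0 = 0) {c₀ : ℝ} (hc₀ : 0 < c₀) (hcb : ∀ b ∈ B, c₀ ≤ c b)
    (hV : ∀ Y ∈ Ys, Measurable (V Y)) {KY : υ → ℝ} (hK : ∀ Y ∈ Ys, ∀ φ, |V Y φ| ≤ KY Y) (hek : 0 < ek) (hek1 : ek < Real.exp (-1))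
    (X : Finset I) (L : Type) [Fintype L] [DecidableEq L] [Nonempty L] {t : ℝ} (ht : t ∈ Set.Ioc (0 : ℝ) 1)
    (h5144 : ∀ γ : L → ↥(slotB B Ys cube X) ⊕ ↥(slotY B Ys cube X), Ineq5144 (cubeSys I) (Finset L)
      (locAct (cubeIn cube X ∘ γ) (actIn blk Δ ℱ adj χ p ek B Φ c Ys V cube Λ X t γ)) Finset.card (fun H (X'' : Finset I) => (X'' \ H.image (cubeIn cube X ∘ γ)).card) θ β') :
    DIn blk Δ ℱ adj χ p ek B Φ c Ys V cube Λ X L t =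
      iteratedDeriv (Fintype.card L) (fun x => Real.log (ztIn blk Δ ℱ χ p ek B Φ c Ys V cube X Λ x)) t := by
  rcases isEmpty_or_nonempty (↥(slotB B Ys cube X) ⊕ ↥(slotY B Ys cube X)) with hE | ⟨⟨τ₀⟩⟩
  · -- no slot located in `X`: both sides vanish
    have hB0 : slotB B Ys cube X = ∅ := Finset.isEmpty_coe_sort.1 (isEmpty_sum.1 hE).1
    have hY0 : slotY B Ys cube X = ∅ := Finset.isEmpty_coe_sort.1 (isEmpty_sum.1 hE).2
    haveI := isProbabilityMeasure_regionLaw blk Δ ℱ hΔ X Λ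
    have hz : (fun x => Real.log (ztIn blk Δ ℱ χ p ek B Φ c Ys V cube X Λ x)) = fun _ => 0 := by
      funext x
      simp only [ztIn, zt_eq, hB0, hY0, prod_empty, sum_empty, mul_zero, neg_zero, Real.exp_zero, mul_one, integral_const,
        probReal_univ, smul_eq_mul, Real.log_one]
    have hn : Fintype.card L ≠ 0 := Fintype.card_ne_zero
    rw [hz, iteratedDeriv_const, if_neg hn]
    exact Fintype.sum_empty _
  · have hsub : Set.Ioc (0 : ℝ) 1 ⊆ Set.Ioo 0 (Real.exp (-1) / ek) := fun x hx =>
      ⟨hx.1, hx.2.trans_lt ((one_lt_div hek).2 hek1)⟩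
    have h := sum_Tsum_univ_eq_iteratedDeriv_log_zG_of_ineq5144_loc blk (interpForm blk Δ (corner ℝ Λ)) ℱ X adj χ
      (B := slotB B Ys cube X) (Φ := fun b : ↥B => Φ b) (c := fun b : ↥B => c b) (Ys := slotY B Ys cube X) (V := fun Y : ↥Ys => V Y)
      (cubeIn cube X) hR hD hnbr hθ0 hθ1 hβ hsmall hχ hp (interpForm_abutting blk Δ adj hΔadj Λ) (prec_interp_corner_posDef blk Δ hΔ X Λ)
      (cubeIn_mem cube X) (fun b φ ψ hh => hΦloc b.1 φ ψ hh) (fun Y φ ψ hh => hVloc Y.1 φ ψ hh) (fun b _ => hΦc b b.2)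
      (fun b _ => hΦ0 b b.2) hc₀ (fun b _ => hcb b b.2) (fun Y _ => hV Y Y.2) (KY := fun Y => KY Y) (fun Y _ φ => hK Y Y.2 φ) hek
      (uniqueDiffOn_Ioc 0 1) hsub (fun _ => τ₀) ht h5144
    have hbr : (fun x => Real.log (ztIn blk Δ ℱ χ p ek B Φ c Ys V cube X Λ x)) = fun x => Real.log
        (zG blk (interpForm blk Δ (corner ℝ Λ)) ℱ (fD (uD χ p ek (slotB B Ys cube X) (fun b : ↥B => Φ b) (fun b : ↥B => c b)
          (slotY B Ys cube X) (fun Y : ↥Ys => V Y) x) (cubeIn cube X) (fun _ : L => τ₀) ∅) X X) :=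
      funext fun x => by rw [ztIn_eq_zG_located blk Δ ℱ χ cube X Λ (fun _ : L => τ₀) x]
    rw [hbr]
    exact h

/-- **THE (5.14.2) REMAINDER DENSITY OF EVERY REGION IS INTEGRABLE ON `[0,1]`, MODULO (5.14.4)** — *"integrating over t as in (5.14.2)"* is a
genuine integral: `t ↦ −((1−t)^{n̄}/(n̄+1)!)·D_X(t)` is interval-integrable on `[0,1]` (on `(0,1]` it is `−(1/(n̄+1))` times the density
`((1−t)^{n̄}/n̄!)(d/dt)^{n̄+1} log z_t(X)` of p36 g12's `BIJ88EffectiveActionL1Remainder308.integrableOn_remainderDensity_of_L1`, whose `L¹` input is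
p36 g13's `BIJ88Eq5145CornerModulus.slotFields_L1_mod_regionLaw` — linear-or-modulus slot fields, p. 309 — and whose `z_t ≠ 0` is `ztIn_pos_of_Ioc`).
[cite: BalabanImbrieJaffe1988, (5.14.2) p.308; p.309; (5.14.4) p.309] -/
theorem intervalIntegrable_weight_DIn_loc {nbr : I → Finset I} {D : ℕ} {θ β' : ℝ} (hR : ∀ x y, adj x y → adj y x)
    (hD : ∀ x, (nbr x).card ≤ D) (hnbr : ∀ x y, adj x y → y ∈ nbr x) (hθ0 : 0 < θ) (hθ1 : θ ≤ 1) (hβ : 0 ≤ β')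
    (hsmall : 16 * ((D : ℝ) + 1) ^ 2 * (θ ^ (β' / 2) * Real.exp 2) ≤ 1) (hχ : ∀ x, 0 ≤ χ.χ₁ x) (hp : 1 / 2 < p)
    (hΔadj : ∀ x y, blk x ≠ blk y → ¬ adj (blk x) (blk y) → Δ x y = 0) (hΔ : Δ.PosDef)
    (hΦloc : ∀ b : B, ∀ φ ψ : α → ℝ, (∀ x, blk x = cube (Sum.inl b) → φ x = ψ x) → Φ b φ = Φ b ψ)
    (hVloc : ∀ Y : Ys, ∀ φ ψ : α → ℝ, (∀ x, blk x = cube (Sum.inr Y) → φ x = ψ x) → V Y φ = V Y ψ)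
    (hmod : ∀ b ∈ B, ∃ ℓ₁ ℓ₂ : (α → ℝ) → ℝ, IsLinearMap ℝ ℓ₁ ∧ IsLinearMap ℝ ℓ₂ ∧
      ((∀ φ, Φ b φ = ℓ₁ φ) ∨ (∀ φ, Φ b φ = Real.sqrt (ℓ₁ φ ^ 2 + ℓ₂ φ ^ 2))))
    {c₀ : ℝ} (hc₀ : 0 < c₀) (hcb : ∀ b ∈ B, c₀ ≤ c b) (hV : ∀ Y ∈ Ys, Measurable (V Y)) {KY : υ → ℝ} (hK : ∀ Y ∈ Ys, ∀ φ, |V Y φ| ≤ KY Y)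
    (hek : 0 < ek) (hek1 : ek < Real.exp (-1)) (X : Finset I) (L : Type) [Fintype L] [DecidableEq L] {nbar : ℕ}
    (hL : Fintype.card L = nbar + 1)
    (h5144 : ∀ t ∈ Set.Ioc (0 : ℝ) 1, ∀ γ : L → ↥(slotB B Ys cube X) ⊕ ↥(slotY B Ys cube X), Ineq5144 (cubeSys I) (Finset L)
      (locAct (cubeIn cube X ∘ γ) (actIn blk Δ ℱ adj χ p ek B Φ c Ys V cube Λ X t γ)) Finset.card (fun H (X'' : Finset I) => (X'' \ H.image (cubeIn cube X ∘ γ)).card) θ β') :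
    IntervalIntegrable (fun t => -((1 - t) ^ nbar / ((nbar + 1).factorial : ℝ)) * DIn blk Δ ℱ adj χ p ek B Φ c Ys V cube Λ X L t)
      volume 0 1 := by
  haveI : Nonempty L := Fintype.card_pos_iff.1 (by omega)
  have hcz : ∀ b ∈ B, Continuous (Φ b) ∧ Φ b 0 = 0 := fun b hb => by
    obtain ⟨ℓ₁, ℓ₂, h₁, h₂, h⟩ := hmod b hb
    exact continuous_and_zero_of_mod h₁ h₂ h
  haveI := isProbabilityMeasure_regionLaw blk Δ ℱ hΔ X Λ
  have hΦ' : ∀ b ∈ slotB B Ys cube X, Measurable fun ω : {x : α // blk x ∈ X} → ℝ => Φ b (ext blk X ω) :=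
    fun b _ => ((hcz b b.2).1.comp (continuous_ext blk X)).measurable
  have hV' : Measurable fun ω : {x : α // blk x ∈ X} → ℝ => ∑ Y ∈ slotY B Ys cube X, V Y (ext blk X ω) :=
    Finset.measurable_sum _ fun Y _ => (hV Y Y.2).comp (measurable_ext blk X)
  have hK' : ∀ ω : {x : α // blk x ∈ X} → ℝ, |∑ Y ∈ slotY B Ys cube X, V Y (ext blk X ω)| ≤ ∑ Y ∈ slotY B Ys cube X, KY Y :=
    fun ω => (abs_sum_le_sum_abs _ _).trans (sum_le_sum fun Y _ => hK Y Y.2 _)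
  have hz : ∀ t ∈ Set.Ioc (0 : ℝ) 1, (∫ ω, (∏ b ∈ slotB B Ys cube X, cutoff χ (c b * pLog p (t * ek)) (Φ b (ext blk X ω))) *
      Real.exp (-(t * ∑ Y ∈ slotY B Ys cube X, V Y (ext blk X ω))) ∂(regionLaw blk Δ ℱ X Λ)) ≠ 0 := fun t ht => by
    have h := ztIn_pos_of_Ioc blk Δ ℱ χ (p := p) (cube := cube) Λ hχ (by linarith) hΔ (fun b hb => (hcz b hb).1)
      (fun b hb => (hcz b hb).2) hc₀ hcb hV hK hek hek1 X ht
    simp only [ztIn, zt_eq] at h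
    exact h.ne'
  have hg : IntegrableOn (fun t => ((1 - t) ^ nbar / (nbar.factorial : ℝ)) *
      iteratedDeriv (nbar + 1) (fun t => Real.log (ztIn blk Δ ℱ χ p ek B Φ c Ys V cube X Λ t)) t) (Set.uIcc (0 : ℝ) 1) := by
    have h := integrableOn_remainderDensity_of_L1 χ (by linarith : 0 < p) (regionLaw blk Δ ℱ X Λ) (slotB B Ys cube X)
      (Φ := fun b ω => Φ b (ext blk X ω)) hΦ' (c := fun b : ↥B => c b) hc₀ (fun b _ => hcb b b.2) hV' hK' hek hek1 hz
      (slotFields_L1_mod_regionLaw blk Δ ℱ χ (Ys := Ys) cube hΔ hp hmod hc₀ hcb hek X Λ) nbar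
    simp only [ztIn, zt_eq]
    exact h
  rw [intervalIntegrable_iff, Set.uIoc_of_le zero_le_one]
  have hg' : IntegrableOn (fun t => (-(1 / (nbar + 1 : ℝ))) * (((1 - t) ^ nbar / (nbar.factorial : ℝ)) *
      iteratedDeriv (nbar + 1) (fun t => Real.log (ztIn blk Δ ℱ χ p ek B Φ c Ys V cube X Λ t)) t)) (Set.Ioc (0 : ℝ) 1) :=
    (hg.mono_set (by rw [Set.uIcc_of_le zero_le_one]; exact Set.Ioc_subset_Icc_self)).const_mul _
  refine hg'.congr_fun (fun t ht => ?_) measurableSet_Ioc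
  rw [DIn_eq_iteratedDeriv_log_ztIn_loc blk Δ ℱ adj χ Λ hR hD hnbr hθ0 hθ1 hβ hsmall hχ (by linarith) hΔadj hΔ hΦloc hVloc
    (fun b hb => (hcz b hb).1) (fun b hb => (hcz b hb).2) hc₀ hcb hV hK hek hek1 X L ht (h5144 t ht), hL]
  have hf0 : (nbar.factorial : ℝ) ≠ 0 := by positivity
  push_cast [Nat.factorial_succ]
  field_simp

/-- **`W₆^{(k)′}(X) = Σ_{X' ⊆ X} (−1)^{|X∖X'|} ℛ(X')` — `W₆′` IS THE MÖBIUS INVERSE, IN THE REGION, OF THE SUB-REGION REMAINDERS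
`ℛ(X') := (n̄+1)·remR(D_{X'})`, MODULO (5.14.4)** (for `X ⊆ W₀`, `|L| = n̄+1`; the leaf for the located data of every sub-region of `W₀` at every
`t ∈ (0,1]`; the hypotheses of `intervalIntegrable_weight_DIn_loc`): `integrand_eq_cornerSum_loc` on `(0,1]` (`remR_congr_Ioc`) and the linearity
`remR_finset_sum`. [cite: BalabanImbrieJaffe1988, p.310 display 4 and the sentence following it; (5.14.2) p.308; (5.14.4) p.309] -/
theorem W6v_eq_cornerSum_loc {nbr : I → Finset I} {D : ℕ} {θ β' : ℝ} (hR : ∀ x y, adj x y → adj y x)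
    (hD : ∀ x, (nbr x).card ≤ D) (hnbr : ∀ x y, adj x y → y ∈ nbr x) (hθ0 : 0 < θ) (hθ1 : θ ≤ 1) (hβ : 0 ≤ β')
    (hsmall : 16 * ((D : ℝ) + 1) ^ 2 * (θ ^ (β' / 2) * Real.exp 2) ≤ 1) (hχ : ∀ x, 0 ≤ χ.χ₁ x) (hp : 1 / 2 < p)
    (hΔadj : ∀ x y, blk x ≠ blk y → ¬ adj (blk x) (blk y) → Δ x y = 0) (hΔ : Δ.PosDef)
    (hΦloc : ∀ b : B, ∀ φ ψ : α → ℝ, (∀ x, blk x = cube (Sum.inl b) → φ x = ψ x) → Φ b φ = Φ b ψ)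
    (hVloc : ∀ Y : Ys, ∀ φ ψ : α → ℝ, (∀ x, blk x = cube (Sum.inr Y) → φ x = ψ x) → V Y φ = V Y ψ)
    (hmod : ∀ b ∈ B, ∃ ℓ₁ ℓ₂ : (α → ℝ) → ℝ, IsLinearMap ℝ ℓ₁ ∧ IsLinearMap ℝ ℓ₂ ∧
      ((∀ φ, Φ b φ = ℓ₁ φ) ∨ (∀ φ, Φ b φ = Real.sqrt (ℓ₁ φ ^ 2 + ℓ₂ φ ^ 2))))
    {c₀ : ℝ} (hc₀ : 0 < c₀) (hcb : ∀ b ∈ B, c₀ ≤ c b) (hV : ∀ Y ∈ Ys, Measurable (V Y)) {KY : υ → ℝ} (hK : ∀ Y ∈ Ys, ∀ φ, |V Y φ| ≤ KY Y)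
    (hek : 0 < ek) (hek1 : ek < Real.exp (-1)) {X W₀ : Finset I} (hXW : X ⊆ W₀) (L : Type) [Fintype L] [DecidableEq L] {nbar : ℕ}
    (hL : Fintype.card L = nbar + 1)
    (h5144 : ∀ X' ⊆ W₀, ∀ t ∈ Set.Ioc (0 : ℝ) 1, ∀ γ : L → ↥(slotB B Ys cube X') ⊕ ↥(slotY B Ys cube X'), Ineq5144 (cubeSys I) (Finset L)
      (locAct (cubeIn cube X' ∘ γ) (actIn blk Δ ℱ adj χ p ek B Φ c Ys V cube Λ X' t γ)) Finset.card (fun H (X'' : Finset I) => (X'' \ H.image (cubeIn cube X' ∘ γ)).card) θ β') :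
    W6v blk Δ ℱ adj χ p ek B Φ c Ys V cube Λ W₀ L nbar X =
      cornerSum (fun X' => (nbar + 1 : ℝ) * remR (DIn blk Δ ℱ adj χ p ek B Φ c Ys V cube Λ X' L) nbar) X := by
  haveI : Nonempty L := Fintype.card_pos_iff.1 (by omega)
  rw [W6v_def, remR_congr_Ioc (fun t ht => integrand_eq_cornerSum_loc blk Δ ℱ adj χ Λ hR hD hnbr hθ0 hθ1 hβ hsmall hXW L
    (h5144 W₀ Subset.rfl t ht)) nbar]
  simp only [cornerSum]
  rw [remR_finset_sum X.powerset (fun X' => (-1 : ℝ) ^ (X \ X').card) (fun X' => DIn blk Δ ℱ adj χ p ek B Φ c Ys V cube Λ X' L) nbar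
    fun X' hX' => intervalIntegrable_weight_DIn_loc blk Δ ℱ adj χ Λ hR hD hnbr hθ0 hθ1 hβ hsmall hχ hp hΔadj hΔ hΦloc hVloc hmod hc₀ hcb hV hK
      hek hek1 X' L hL (h5144 X' ((mem_powerset.1 hX').trans hXW)), mul_sum]
  exact sum_congr rfl fun X' _ => by ring

/-- **DISPLAY 4 OF p. 310 DERIVED, MODULO (5.14.4): `Σ_{X ⊆ W₀} W₆^{(k)′}(X) = ℛ(W₀) = (n̄+1)·remR(t ↦ Σ_γ T[W₀-gas]_{γ,t}(L))`** — the sum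
over the regions `X ⊆ W₀` of the printed `W₆′(X)` IS the exponent term `ℛ_k(Λ₁₂)` of the (5.14.5) head theorem
(`BIJ88Eq5145CornerModulus.eq5145_zG_mod_remR_of_ineq5144`, with `W₀ = Λ₁₂ = lam12 W ρ`, `Λ = Λ₁₂′ = lam12' adj W ρ`), which read display 4 as
the DEFINITION of the `W₆′`-sum: Möbius inversion (`BIJ88Clusters5134.sum_powerset_cornerSum`) of `W6v_eq_cornerSum_loc`.  Hypotheses: those of
`W6v_eq_cornerSum_loc` (the leaf (5.14.4) for the located data of every sub-region of `W₀` at every `t ∈ (0,1]`, in gen 5's regime).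
[cite: BalabanImbrieJaffe1988, p.310 display 4; (5.14.2) p.308; (5.14.4) p.309; (5.14.5) p.312] -/
theorem display4_loc {nbr : I → Finset I} {D : ℕ} {θ β' : ℝ} (hR : ∀ x y, adj x y → adj y x)
    (hD : ∀ x, (nbr x).card ≤ D) (hnbr : ∀ x y, adj x y → y ∈ nbr x) (hθ0 : 0 < θ) (hθ1 : θ ≤ 1) (hβ : 0 ≤ β')
    (hsmall : 16 * ((D : ℝ) + 1) ^ 2 * (θ ^ (β' / 2) * Real.exp 2) ≤ 1) (hχ : ∀ x, 0 ≤ χ.χ₁ x) (hp : 1 / 2 < p)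
    (hΔadj : ∀ x y, blk x ≠ blk y → ¬ adj (blk x) (blk y) → Δ x y = 0) (hΔ : Δ.PosDef)
    (hΦloc : ∀ b : B, ∀ φ ψ : α → ℝ, (∀ x, blk x = cube (Sum.inl b) → φ x = ψ x) → Φ b φ = Φ b ψ)
    (hVloc : ∀ Y : Ys, ∀ φ ψ : α → ℝ, (∀ x, blk x = cube (Sum.inr Y) → φ x = ψ x) → V Y φ = V Y ψ)
    (hmod : ∀ b ∈ B, ∃ ℓ₁ ℓ₂ : (α → ℝ) → ℝ, IsLinearMap ℝ ℓ₁ ∧ IsLinearMap ℝ ℓ₂ ∧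
      ((∀ φ, Φ b φ = ℓ₁ φ) ∨ (∀ φ, Φ b φ = Real.sqrt (ℓ₁ φ ^ 2 + ℓ₂ φ ^ 2))))
    {c₀ : ℝ} (hc₀ : 0 < c₀) (hcb : ∀ b ∈ B, c₀ ≤ c b) (hV : ∀ Y ∈ Ys, Measurable (V Y)) {KY : υ → ℝ} (hK : ∀ Y ∈ Ys, ∀ φ, |V Y φ| ≤ KY Y)
    (hek : 0 < ek) (hek1 : ek < Real.exp (-1)) (W₀ : Finset I) (L : Type) [Fintype L] [DecidableEq L] {nbar : ℕ}
    (hL : Fintype.card L = nbar + 1)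
    (h5144 : ∀ X' ⊆ W₀, ∀ t ∈ Set.Ioc (0 : ℝ) 1, ∀ γ : L → ↥(slotB B Ys cube X') ⊕ ↥(slotY B Ys cube X'), Ineq5144 (cubeSys I) (Finset L)
      (locAct (cubeIn cube X' ∘ γ) (actIn blk Δ ℱ adj χ p ek B Φ c Ys V cube Λ X' t γ)) Finset.card (fun H (X'' : Finset I) => (X'' \ H.image (cubeIn cube X' ∘ γ)).card) θ β') :
    ∑ X ∈ W₀.powerset, W6v blk Δ ℱ adj χ p ek B Φ c Ys V cube Λ W₀ L nbar X =
      (nbar + 1 : ℝ) * remR (DIn blk Δ ℱ adj χ p ek B Φ c Ys V cube Λ W₀ L) nbar := by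
  rw [← sum_powerset_cornerSum (fun X' => (nbar + 1 : ℝ) * remR (DIn blk Δ ℱ adj χ p ek B Φ c Ys V cube Λ X' L) nbar) W₀]
  exact sum_congr rfl fun X hX => W6v_eq_cornerSum_loc blk Δ ℱ adj χ Λ hR hD hnbr hθ0 hθ1 hβ hsmall hχ hp hΔadj hΔ hΦloc hVloc hmod hc₀ hcb hV
    hK hek hek1 (mem_powerset.1 hX) L hL h5144

/-- **DISPLAY 4 IN THE LITERAL SHAPE OF THE HEAD THEOREM'S `hrem`** (`(n̄+1)·remR(t ↦ Σ_{γ'} Tsum[W₀-gas]_{γ',t}(univ)) = Σ_{X ⊆ W₀} W₆′(X)`):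
the exponent term of `BIJ88Eq5145CornerModulus.eq5145_zG_mod_remR_of_ineq5144` / the hypothesis `hrem` of `…_Tsum_of_ineq5144` with
`𝒳 := W₀.powerset`, `W6p := W6v`. [cite: BalabanImbrieJaffe1988, p.310 display 4; (5.14.5) p.312] -/
theorem remR_sum_Tsum_eq_sum_W6v_loc {nbr : I → Finset I} {D : ℕ} {θ β' : ℝ} (hR : ∀ x y, adj x y → adj y x)
    (hD : ∀ x, (nbr x).card ≤ D) (hnbr : ∀ x y, adj x y → y ∈ nbr x) (hθ0 : 0 < θ) (hθ1 : θ ≤ 1) (hβ : 0 ≤ β')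
    (hsmall : 16 * ((D : ℝ) + 1) ^ 2 * (θ ^ (β' / 2) * Real.exp 2) ≤ 1) (hχ : ∀ x, 0 ≤ χ.χ₁ x) (hp : 1 / 2 < p)
    (hΔadj : ∀ x y, blk x ≠ blk y → ¬ adj (blk x) (blk y) → Δ x y = 0) (hΔ : Δ.PosDef)
    (hΦloc : ∀ b : B, ∀ φ ψ : α → ℝ, (∀ x, blk x = cube (Sum.inl b) → φ x = ψ x) → Φ b φ = Φ b ψ)
    (hVloc : ∀ Y : Ys, ∀ φ ψ : α → ℝ, (∀ x, blk x = cube (Sum.inr Y) → φ x = ψ x) → V Y φ = V Y ψ)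
    (hmod : ∀ b ∈ B, ∃ ℓ₁ ℓ₂ : (α → ℝ) → ℝ, IsLinearMap ℝ ℓ₁ ∧ IsLinearMap ℝ ℓ₂ ∧
      ((∀ φ, Φ b φ = ℓ₁ φ) ∨ (∀ φ, Φ b φ = Real.sqrt (ℓ₁ φ ^ 2 + ℓ₂ φ ^ 2))))
    {c₀ : ℝ} (hc₀ : 0 < c₀) (hcb : ∀ b ∈ B, c₀ ≤ c b) (hV : ∀ Y ∈ Ys, Measurable (V Y)) {KY : υ → ℝ} (hK : ∀ Y ∈ Ys, ∀ φ, |V Y φ| ≤ KY Y)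
    (hek : 0 < ek) (hek1 : ek < Real.exp (-1)) (W₀ : Finset I) (L : Type) [Fintype L] [DecidableEq L] {nbar : ℕ}
    (hL : Fintype.card L = nbar + 1)
    (h5144 : ∀ X' ⊆ W₀, ∀ t ∈ Set.Ioc (0 : ℝ) 1, ∀ γ : L → ↥(slotB B Ys cube X') ⊕ ↥(slotY B Ys cube X'), Ineq5144 (cubeSys I) (Finset L)
      (locAct (cubeIn cube X' ∘ γ) (actIn blk Δ ℱ adj χ p ek B Φ c Ys V cube Λ X' t γ)) Finset.card (fun H (X'' : Finset I) => (X'' \ H.image (cubeIn cube X' ∘ γ)).card) θ β') :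
    (nbar + 1 : ℝ) * remR (fun t => ∑ γ' : L → ↥(slotB B Ys cube W₀) ⊕ ↥(slotY B Ys cube W₀),
        Tsum ((polysOf W₀).image (cvsupp adj W₀)) (locv (cubeIn cube W₀ ∘ γ'))
          (wv (prime (g3 adj fun H' => zG blk (interpForm blk Δ (corner ℝ Λ)) ℱ
            (fD (uD χ p ek (slotB B Ys cube W₀) (fun b : ↥B => Φ b) (fun b : ↥B => c b) (slotY B Ys cube W₀) (fun Y : ↥Ys => V Y) t)
              (cubeIn cube W₀) γ' H')))) univ) nbar =
      ∑ X ∈ W₀.powerset, W6v blk Δ ℱ adj χ p ek B Φ c Ys V cube Λ W₀ L nbar X :=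
  (display4_loc blk Δ ℱ adj χ Λ hR hD hnbr hθ0 hθ1 hβ hsmall hχ hp hΔadj hΔ hΦloc hVloc hmod hc₀ hcb hV hK hek hek1 W₀ L hL h5144).symm

/-! ## §2 The integrand bound, `|W₆′(X)|`, the printed shape and r16's `IneqW6'`, from the located leaf (gen 13 `BIJ88W6PrimeVsuppBound`) -/

/-- **(5.14.4) ⟹ THE INTEGRAND OF `W₆′(X)` IS BOUNDED ON `(0,1]`**: for `X ⊆ W₀` and the leaf for the located data of `W₀` at `t`,
`|Σ_{γ : supp ⊆ X} T^{fill X}_{γ,t}(L)| ≤ (G|X|)^{|L|}·(θ^{β′/2})^{|X|}·((θ^{1−β′})^{|L|}·|L|!·4e²θ^{β′/2}(D+1)·|X|)`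
(`BIJ88ConnectedGraphFillingVsupp.abs_TsumFill_vsupp_le_of_ineq5144_loc` per assignment + `card_filter_supp_le`).
[cite: BalabanImbrieJaffe1988, p.310 (Sect. 5.14); (5.14.4) p.309] -/
theorem abs_integrand_le_loc {nbr : I → Finset I} {D : ℕ} {θ β' : ℝ} (hR : ∀ x y, adj x y → adj y x) (hD : ∀ x, (nbr x).card ≤ D)
    (hnbr : ∀ x y, adj x y → y ∈ nbr x) (hθ0 : 0 < θ) (hθ1 : θ ≤ 1) (hβ : 0 ≤ β') (hsmall : 16 * ((D : ℝ) + 1) ^ 2 * (θ ^ (β' / 2) * Real.exp 2) ≤ 1)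
    {X W₀ : Finset I} (hXW : X ⊆ W₀) {G : ℕ}
    (hG : ∀ i, (univ.filter fun τ : ↥(slotB B Ys cube W₀) ⊕ ↥(slotY B Ys cube W₀) => cubeIn cube W₀ τ = i).card ≤ G)
    (L : Type) [Fintype L] [DecidableEq L] [Nonempty L] {t : ℝ}
    (h5144 : ∀ γ : L → ↥(slotB B Ys cube W₀) ⊕ ↥(slotY B Ys cube W₀), Ineq5144 (cubeSys I) (Finset L)
      (locAct (cubeIn cube W₀ ∘ γ) (actIn blk Δ ℱ adj χ p ek B Φ c Ys V cube Λ W₀ t γ)) Finset.card (fun H (X'' : Finset I) => (X'' \ H.image (cubeIn cube W₀ ∘ γ)).card) θ β') :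
    |∑ γ ∈ univ.filter (fun γ : L → ↥(slotB B Ys cube W₀) ⊕ ↥(slotY B Ys cube W₀) => ∀ l, cubeIn cube W₀ (γ l) ∈ X),
        TsumFill ((polysOf W₀).image (cvsupp adj W₀)) (locv (cubeIn cube W₀ ∘ γ)) (wv (actIn blk Δ ℱ adj χ p ek B Φ c Ys V cube Λ W₀ t γ))
          cubesOf X univ| ≤
      ((G : ℝ) * X.card) ^ Fintype.card L * ((θ ^ (β' / 2)) ^ X.card * ((θ ^ (1 - β')) ^ Fintype.card L * (Fintype.card L).factorial *
        (2 * (2 * Real.exp 2 * θ ^ (β' / 2) * ((D : ℝ) + 1)) * X.card))) := by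
  have hB : 0 ≤ (θ ^ (β' / 2)) ^ X.card * ((θ ^ (1 - β')) ^ Fintype.card L * (Fintype.card L).factorial *
      (2 * (2 * Real.exp 2 * θ ^ (β' / 2) * ((D : ℝ) + 1)) * X.card)) := by positivity
  refine (abs_sum_le_sum_abs _ _).trans (((sum_le_sum fun γ _ =>
    abs_TsumFill_vsupp_le_of_ineq5144_loc hR hD hnbr hθ0 hθ1 hβ hsmall (h5144 γ) hXW univ_nonempty)).trans ?_)
  rw [sum_const, nsmul_eq_mul, card_univ]
  exact mul_le_mul_of_nonneg_right (card_filter_supp_le hG L X) hB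

/-- **`|W₆^{(k)′}(X)|`, QUANTITATIVE FORM, MODULO (5.14.4)** (p25's steps (a)–(f) for the printed `W₆′`): for `X ⊆ W₀`, `|L| = n̄+1`, at most `G`
slots of `W₀` per cube, gen 5's regime and the leaf for the located data of `W₀` at every `t ∈ (0,1]`,
`|W₆′(X)| ≤ 4e²θ^{β′/2}(D+1)(n̄+1)·G^{n̄+1}|X|^{n̄+2}·(θ^{1−β′})^{n̄+1}(θ^{β′/2})^{|X|}` (`abs_integrand_le_loc` on `(0,1]`, `abs_remR_le_of_bound`,
`(n̄+1)·(n̄+1)!/(n̄+1)! = n̄+1`). [cite: BalabanImbrieJaffe1988, p.310 (Sect. 5.14); (5.14.2) p.308; (5.14.4) p.309] -/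
theorem abs_W6v_le_loc {nbr : I → Finset I} {D : ℕ} {θ β' : ℝ} (hR : ∀ x y, adj x y → adj y x) (hD : ∀ x, (nbr x).card ≤ D)
    (hnbr : ∀ x y, adj x y → y ∈ nbr x) (hθ0 : 0 < θ) (hθ1 : θ ≤ 1) (hβ : 0 ≤ β') (hsmall : 16 * ((D : ℝ) + 1) ^ 2 * (θ ^ (β' / 2) * Real.exp 2) ≤ 1)
    {X W₀ : Finset I} (hXW : X ⊆ W₀) {G : ℕ}
    (hG : ∀ i, (univ.filter fun τ : ↥(slotB B Ys cube W₀) ⊕ ↥(slotY B Ys cube W₀) => cubeIn cube W₀ τ = i).card ≤ G)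
    (L : Type) [Fintype L] [DecidableEq L] {nbar : ℕ} (hL : Fintype.card L = nbar + 1)
    (h5144 : ∀ t ∈ Set.Ioc (0 : ℝ) 1, ∀ γ : L → ↥(slotB B Ys cube W₀) ⊕ ↥(slotY B Ys cube W₀), Ineq5144 (cubeSys I) (Finset L)
      (locAct (cubeIn cube W₀ ∘ γ) (actIn blk Δ ℱ adj χ p ek B Φ c Ys V cube Λ W₀ t γ)) Finset.card (fun H (X'' : Finset I) => (X'' \ H.image (cubeIn cube W₀ ∘ γ)).card) θ β') :
    |W6v blk Δ ℱ adj χ p ek B Φ c Ys V cube Λ W₀ L nbar X| ≤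
      4 * Real.exp 2 * θ ^ (β' / 2) * ((D : ℝ) + 1) * (nbar + 1 : ℝ) * (G : ℝ) ^ (nbar + 1) * (X.card : ℝ) ^ (nbar + 2) *
        ((θ ^ (1 - β')) ^ (nbar + 1) * (θ ^ (β' / 2)) ^ X.card) := by
  haveI : Nonempty L := Fintype.card_pos_iff.1 (by omega)
  have hI := fun t (ht : t ∈ Set.Ioc (0 : ℝ) 1) =>
    abs_integrand_le_loc blk Δ ℱ adj χ Λ hR hD hnbr hθ0 hθ1 hβ hsmall hXW hG L (h5144 t ht)
  rw [hL] at hI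
  have hrem := abs_remR_le_of_bound hI nbar
  have hfac : ((nbar + 1).factorial : ℝ) ≠ 0 := by positivity
  rw [W6v_def, abs_mul, abs_of_nonneg (by positivity : (0 : ℝ) ≤ nbar + 1)]
  refine (mul_le_mul_of_nonneg_left hrem (by positivity)).trans (le_of_eq ?_)
  field_simp
  ring

/-- **`|W₆^{(k)′}(X)| ≤ θ^{(1−β′)(n̄+1) + (β′/4)|X|}` — THE PRINTED SHAPE, MODULO (5.14.4)** (p. 310 *"The result is |W₆^{(k)′}(X)| ≤
(e^β(L^kε/ε₀)^{1/4−α})^{n̄+1+β′|X|}. (We allow adjustments in β, α, β′, keeping them small.)"*): `abs_W6v_le_loc` for `X ⊆ W₀`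
(`W6v_eq_zero_of_not_subset` otherwise) and the absorption `K|X|^{n̄+2}θ^{(β′/4)|X|} ≤ 1` under `K(n̄+2)! ≤ ((β′/4) log θ⁻¹)^{n̄+2}`,
`K = 4e²θ^{β′/2}(D+1)(n̄+1)G^{n̄+1}` (p25's `BIJ88W6PrimeBound.mul_pow_mul_rpow_le_one`). [cite: BalabanImbrieJaffe1988, p.310 (Sect. 5.14); (5.14.4) p.309] -/
theorem abs_W6v_le_rpow_loc {nbr : I → Finset I} {D : ℕ} {θ β' : ℝ} (hR : ∀ x y, adj x y → adj y x) (hD : ∀ x, (nbr x).card ≤ D)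
    (hnbr : ∀ x y, adj x y → y ∈ nbr x) (hθ0 : 0 < θ) (hθ1 : θ ≤ 1) (hβ : 0 ≤ β') (hsmall : 16 * ((D : ℝ) + 1) ^ 2 * (θ ^ (β' / 2) * Real.exp 2) ≤ 1)
    (W₀ : Finset I) {G : ℕ} (hG : ∀ i, (univ.filter fun τ : ↥(slotB B Ys cube W₀) ⊕ ↥(slotY B Ys cube W₀) => cubeIn cube W₀ τ = i).card ≤ G)
    (L : Type) [Fintype L] [DecidableEq L] {nbar : ℕ} (hL : Fintype.card L = nbar + 1)
    (habs : 4 * Real.exp 2 * θ ^ (β' / 2) * ((D : ℝ) + 1) * (nbar + 1 : ℝ) * (G : ℝ) ^ (nbar + 1) * (nbar + 2).factorial ≤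
      (β' / 4 * Real.log θ⁻¹) ^ (nbar + 2))
    (h5144 : ∀ t ∈ Set.Ioc (0 : ℝ) 1, ∀ γ : L → ↥(slotB B Ys cube W₀) ⊕ ↥(slotY B Ys cube W₀), Ineq5144 (cubeSys I) (Finset L)
      (locAct (cubeIn cube W₀ ∘ γ) (actIn blk Δ ℱ adj χ p ek B Φ c Ys V cube Λ W₀ t γ)) Finset.card (fun H (X'' : Finset I) => (X'' \ H.image (cubeIn cube W₀ ∘ γ)).card) θ β')
    (X : Finset I) :
    |W6v blk Δ ℱ adj χ p ek B Φ c Ys V cube Λ W₀ L nbar X| ≤ θ ^ ((1 - β') * (nbar + 1) + β' / 4 * X.card) := by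
  by_cases hXW : X ⊆ W₀
  swap
  · rw [W6v_eq_zero_of_not_subset blk Δ ℱ adj χ Λ hXW L nbar, abs_zero]
    exact Real.rpow_nonneg hθ0.le _
  have h := abs_W6v_le_loc blk Δ ℱ adj χ Λ hR hD hnbr hθ0 hθ1 hβ hsmall hXW hG L hL h5144
  set K : ℝ := 4 * Real.exp 2 * θ ^ (β' / 2) * ((D : ℝ) + 1) * (nbar + 1 : ℝ) * (G : ℝ) ^ (nbar + 1) with hK
  have hK0 : 0 ≤ K := by positivity
  have habs' : K * (nbar + 2).factorial ≤ (β' / 4 * Real.log θ⁻¹) ^ (nbar + 2) := by rw [hK]; exact habs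
  have hab := mul_pow_mul_rpow_le_one hθ0 hθ1 hK0 (by positivity : (0 : ℝ) ≤ β' / 4) (Nat.cast_nonneg X.card) (m := nbar + 2) habs'
  have hpow1 : (θ ^ (1 - β')) ^ (nbar + 1) = θ ^ ((1 - β') * (nbar + 1)) := by
    rw [← Real.rpow_natCast, ← Real.rpow_mul hθ0.le]; norm_cast
  have hpow2 : (θ ^ (β' / 2)) ^ X.card = θ ^ (β' / 4 * (X.card : ℝ)) * θ ^ (β' / 4 * (X.card : ℝ)) := by
    rw [← Real.rpow_natCast, ← Real.rpow_mul hθ0.le, ← Real.rpow_add hθ0]; congr 1; ring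
  have hgoal : θ ^ ((1 - β') * (nbar + 1) + β' / 4 * X.card) = θ ^ ((1 - β') * (nbar + 1)) * θ ^ (β' / 4 * (X.card : ℝ)) :=
    Real.rpow_add hθ0 _ _
  have hpos : 0 ≤ θ ^ ((1 - β') * (nbar + 1)) * θ ^ (β' / 4 * (X.card : ℝ)) := mul_nonneg (Real.rpow_nonneg hθ0.le _) (Real.rpow_nonneg hθ0.le _)
  calc |W6v blk Δ ℱ adj χ p ek B Φ c Ys V cube Λ W₀ L nbar X|
      ≤ K * (X.card : ℝ) ^ (nbar + 2) * ((θ ^ (1 - β')) ^ (nbar + 1) * (θ ^ (β' / 2)) ^ X.card) := by rw [hK]; exact h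
    _ = (θ ^ ((1 - β') * (nbar + 1)) * θ ^ (β' / 4 * (X.card : ℝ))) * (K * (X.card : ℝ) ^ (nbar + 2) * θ ^ (β' / 4 * (X.card : ℝ))) := by
        rw [hpow1, hpow2]; ring
    _ ≤ (θ ^ ((1 - β') * (nbar + 1)) * θ ^ (β' / 4 * (X.card : ℝ))) * 1 := mul_le_mul_of_nonneg_left hab hpos
    _ = θ ^ ((1 - β') * (nbar + 1) + β' / 4 * X.card) := by rw [mul_one, hgoal]

/-- **r16's TYPED LEAF `IneqW6'` FOR THE PRINTED `W₆′` OF THE BOOKKEEPING OF RECORD, MODULO (5.14.4)** (row C2.Claim@310, p. 310): under the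
hypotheses of `abs_W6v_le_rpow_loc` and `β′ < 1`, `IneqW6' (cubeSys I) (W6v … W₀ L n̄) (θ^{1−β′}) (β′/(4(1−β′))) n̄` — verbatim the printed
`|W₆^{(k)′}(X)| ≤ ϑ^{n̄+1+β″|X|}` with p25's adjusted vertex factor `ϑ = θ^{1−β′}` and `β″ = β′/(4(1−β′))` (*"We allow adjustments in β, α,
β′"*), now for the `W₆′` whose region sum IS the `ℛ_k` of the (5.14.5) head theorem (`BIJ88W6PrimeVsupp.display4_loc`); feeds r16's
`BIJ88IneqW6FromLeaves.ineqW6_of_leaves` as its `hW6p`. [cite: BalabanImbrieJaffe1988, p.310 (Sect. 5.14); (5.14.4) p.309] -/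
theorem ineqW6'_W6v_loc {nbr : I → Finset I} {D : ℕ} {θ β' : ℝ} (hR : ∀ x y, adj x y → adj y x) (hD : ∀ x, (nbr x).card ≤ D)
    (hnbr : ∀ x y, adj x y → y ∈ nbr x) (hθ0 : 0 < θ) (hθ1 : θ ≤ 1) (hβ : 0 ≤ β') (hβ1 : β' < 1)
    (hsmall : 16 * ((D : ℝ) + 1) ^ 2 * (θ ^ (β' / 2) * Real.exp 2) ≤ 1)
    (W₀ : Finset I) {G : ℕ} (hG : ∀ i, (univ.filter fun τ : ↥(slotB B Ys cube W₀) ⊕ ↥(slotY B Ys cube W₀) => cubeIn cube W₀ τ = i).card ≤ G)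
    (L : Type) [Fintype L] [DecidableEq L] {nbar : ℕ} (hL : Fintype.card L = nbar + 1)
    (habs : 4 * Real.exp 2 * θ ^ (β' / 2) * ((D : ℝ) + 1) * (nbar + 1 : ℝ) * (G : ℝ) ^ (nbar + 1) * (nbar + 2).factorial ≤
      (β' / 4 * Real.log θ⁻¹) ^ (nbar + 2))
    (h5144 : ∀ t ∈ Set.Ioc (0 : ℝ) 1, ∀ γ : L → ↥(slotB B Ys cube W₀) ⊕ ↥(slotY B Ys cube W₀), Ineq5144 (cubeSys I) (Finset L)
      (locAct (cubeIn cube W₀ ∘ γ) (actIn blk Δ ℱ adj χ p ek B Φ c Ys V cube Λ W₀ t γ)) Finset.card (fun H (X'' : Finset I) => (X'' \ H.image (cubeIn cube W₀ ∘ γ)).card) θ β') :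
    IneqW6' (cubeSys I) (W6v blk Δ ℱ adj χ p ek B Φ c Ys V cube Λ W₀ L nbar) (θ ^ (1 - β')) (β' / (4 * (1 - β'))) nbar := by
  intro X
  have h := abs_W6v_le_rpow_loc blk Δ ℱ adj χ Λ hR hD hnbr hθ0 hθ1 hβ hsmall W₀ hG L hL habs h5144 X
  have hb : (1 : ℝ) - β' ≠ 0 := by linarith
  have hexp : (θ ^ (1 - β')) ^ ((nbar : ℝ) + 1 + β' / (4 * (1 - β')) * ((cubeSys I).card X : ℝ)) =
      θ ^ ((1 - β') * (nbar + 1) + β' / 4 * X.card) := by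
    rw [← Real.rpow_mul hθ0.le, cubeSys_card]
    congr 1
    field_simp
  rw [hexp]
  exact h


end Literature.MathematicalPhysics.QuantumFieldTheory.BalabanImbrieJaffe1984to88.BIJ88W6PrimeVsuppLoc

end
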